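import Mathlib
import HarnessLib
import Summits.Ventures.LatticeQCDFlow.Scaling.AutoregressiveGaugePlaquetteTVFloorAnyLink
import Summits.Ventures.LatticeQCDFlow.Scaling.WilsonPlaquetteMateCoupling
import Summits.Ventures.LatticeQCDFlow.Scaling.PlaquetteTopLinkOrders

/-!
# LatticeQCDFlow / Scaling — peeling a ranked plaquette collection: `Z_B = (∫ w)^{#B}` and the product
# of the one-plaquette conditioners is `F_B/Z_B`, in every dimension

HONEST FRAMING: exact (Metropolis-corrected) sampling algorithms for lattice gauge theory;
figures of merit are autocorrelation/cost numbers at stated couplings and volumes; no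
continuum-physics claim.

Venture `LatticeQCDFlow` (cell pub-lqcd), topic `Scaling`, FANOUT row 30 (lean-1, GEN-23) — OUR WORK on
THEORY-2.md §4 row C5, the analytic half of heat-bath exactness beyond rectangles.
`Scaling/AutoregressiveGaugeHeatBathExact2D` proved, for a free-boundary RECTANGLE `B` of `(ℤ/L)²`, that
`Z_B = ∫ ∏_{p∈B} w(U_p) dHaar^{⊗E} = c^{#B}` (`c = ∫ w dHaar`) and that the one-plaquette heat-bath
conditioners multiply to `F_B/c^{#B}`, by row 5's column peeling.  Here the same holds for EVERY
collection `B` of plaquettes of `(ℤ/L)^d`, in EVERY dimension `d`, that is RANKED for a top-link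
assignment `t` (`t p` a link of `p`; `rank p < rank p'` whenever `t p` lies on another `p' ∈ B` — the
hypothesis of `Scaling/PlaquetteTopLinkOrders.exists_order_of_topLink_rank`): remove the plaquette of
maximal rank — its top link lies on no other plaquette of `B`, so redrawing that single link averages
`w(U_p)` to `c` whatever the other links are (`integral_comp_plaquetteHolonomy_mul_of_mem`: Haar
invariance at any of the four positions) — and induct (`Finset.induction_on_max_value`).  With the
comb of `Scaling/TorusTopLinkComb` (all plaquettes of `(ℤ/L)²` but one are ranked) and
`Scaling/AutoregressiveGaugeHeatBathTorusTauInt` (`k = #Bᶜ = 1`): the autoregressive sampler whose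
conditioner at `t p` is `w(U_p)/c` (and `1` at every other link), run along the comb's order, has
density `∏_b q_b = F_B/Z_B` — it samples `q_B` EXACTLY — and the exact Metropolis chain it drives for
the periodic target has `τ_int ≤ M/m − 1/2` for every bounded observable, UNIFORMLY IN THE VOLUME.

## What is proved (all [ours])

* **`integral_prod_weight_eq_pow_of_rank`** — `L ≥ 2`, `w` continuous with `0 < m ≤ w ≤ M`, `B` ranked
  for `t`: `∫ ∏_{p∈B} w(U_p) dHaar^{⊗E} = (∫ w dHaar)^{#B}`.
* **`prod_conditioner_eq`** — `∏_{b} ∏_{p ∈ B, t p = b} w(U_p)/c = F_B(U)/c^{#B}`: the product over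
  ALL links of the one-plaquette conditioners is the normalised weight (so, with the peeling theorem,
  the autoregressive model with these conditioners has density `F_B/Z_B` against `Haar^{⊗E}` — its
  legitimacy as an ancestral sampler along a compatible order is `PlaquetteTopLinkOrders` §4, and the
  normalisation of each conditioner in its own link is the Haar averaging of
  `AutoregressiveGaugePlaquetteTVFloorAnyLink.integral_comp_plaquetteHolonomy_mul_of_mem`).

No `def`, no `sorry`, nothing cited as a fact.
-/

namespace Summit.Ventures.LatticeQCDFlow.Theory2.Autoregressive

open MeasureTheory Function Finset
open Literature.MathematicalPhysics.QuantumFieldTheory Literature.MathematicalPhysics.QuantumLattice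
open Summit.Ventures.LatticeQCDFlow.Exactness

variable {d L : ℕ} [NeZero L] {G : Type*} [Group G] [TopologicalSpace G] [IsTopologicalGroup G]
  [CompactSpace G] [SecondCountableTopology G] [MeasurableSpace G] [BorelSpace G]

/-- **Peeling a ranked collection: `Z_B = c^{#B}`.**  `L ≥ 2`; `w` continuous, `0 < m ≤ w ≤ M`; `t p` a
link of `p` for `p ∈ B`, and `rank p < rank p'` whenever `t p` lies on another plaquette `p' ∈ B`.
Then `∫ ∏_{p∈B} w(U_p) dHaar^{⊗E} = (∫ w dHaar)^{#B}`. [ours] -/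
theorem integral_prod_weight_eq_pow_of_rank (hL : 2 ≤ L) {w : G → ℝ} (hw : Continuous w) {m M : ℝ}
    (hm0 : 0 < m) (hm : ∀ g, m ≤ w g) (hM : ∀ g, w g ≤ M) (B : Finset (Plaquette d L))
    (t : Plaquette d L → Edge d L)
    (ht : ∀ p ∈ B, t p ∈ ({(p.1, p.2.1.1), (p.1.shift p.2.1.1, p.2.1.2),
        (p.1.shift p.2.1.2, p.2.1.1), (p.1, p.2.1.2)} : Finset (Edge d L)))
    (rank : Plaquette d L → ℕ)
    (hrank : ∀ p ∈ B, ∀ p' ∈ B, p ≠ p' → t p ∈ ({(p'.1, p'.2.1.1), (p'.1.shift p'.2.1.1, p'.2.1.2),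
        (p'.1.shift p'.2.1.2, p'.2.1.1), (p'.1, p'.2.1.2)} : Finset (Edge d L)) → rank p < rank p') :
    ∫ U, ∏ p ∈ B, w (plaquetteHolonomy U p.1 p.2.1.1 p.2.1.2)
        ∂(Measure.pi fun _ : Edge d L => haarProbability G) =
      (∫ g, w g ∂(haarProbability G)) ^ B.card := by
  classical
  have hw0 : ∀ g, 0 < w g := fun g => hm0.trans_le (hm g)
  have hMpos : 0 < M := (hw0 1).trans_le (hM 1)
  have hwb : ∀ g, |w g| ≤ M := fun g => by rw [abs_of_pos (hw0 g)]; exact hM g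
  revert ht hrank
  refine Finset.induction_on_max_value rank B ?_ ?_
  · intro _ _; simp
  · intro a s has hmax ih ht hrank
    have hta := ht a (Finset.mem_insert_self a s)
    have hts : ∀ p ∈ s, t p ∈ ({(p.1, p.2.1.1), (p.1.shift p.2.1.1, p.2.1.2),
        (p.1.shift p.2.1.2, p.2.1.1), (p.1, p.2.1.2)} : Finset (Edge d L)) :=
      fun p hp => ht p (Finset.mem_insert_of_mem hp)
    have hranks : ∀ p ∈ s, ∀ p' ∈ s, p ≠ p' → t p ∈ ({(p'.1, p'.2.1.1), (p'.1.shift p'.2.1.1, p'.2.1.2),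
        (p'.1.shift p'.2.1.2, p'.2.1.1), (p'.1, p'.2.1.2)} : Finset (Edge d L)) → rank p < rank p' :=
      fun p hp p' hp' => hrank p (Finset.mem_insert_of_mem hp) p' (Finset.mem_insert_of_mem hp')
    -- the top link of `a` lies on no plaquette of `s` (maximality of `rank a`)
    have hfree : ∀ p ∈ s, t a ∉ ({(p.1, p.2.1.1), (p.1.shift p.2.1.1, p.2.1.2),
        (p.1.shift p.2.1.2, p.2.1.1), (p.1, p.2.1.2)} : Finset (Edge d L)) := by
      intro p hp hmem
      have hne : a ≠ p := fun h => has (h ▸ hp)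
      have := hrank a (Finset.mem_insert_self a s) p (Finset.mem_insert_of_mem hp) hne hmem
      exact absurd (hmax p hp) (not_le.2 this)
    -- the remaining product is blind to the link `t a`
    set Φ : GaugeConfig d L G → ℝ := fun U => ∏ p ∈ s, w (plaquetteHolonomy U p.1 p.2.1.1 p.2.1.2)
      with hΦ
    have hΦe : ∀ U v, Φ (update U (t a) v) = Φ U := by
      intro U v
      refine Finset.prod_congr rfl fun p hp => ?_
      have h := hfree p hp
      simp only [Finset.mem_insert, Finset.mem_singleton, not_or] at h
      obtain ⟨h1, h2, h3, h4⟩ := h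
      rw [plaquetteHolonomy_update_of_ne U v (Ne.symm h1) (Ne.symm h2) (Ne.symm h3) (Ne.symm h4)]
    have hΦm : Measurable Φ :=
      Finset.measurable_prod s fun p _ =>
        hw.measurable.comp (measurable_plaquetteHolonomy p.1 p.2.1.1 p.2.1.2)
    have hΦb : ∀ U, |Φ U| ≤ M ^ s.card := by
      intro U
      have hpos : 0 < Φ U := prod_pos fun p _ => hw0 _
      rw [abs_of_pos hpos, hΦ, ← Finset.prod_const]
      exact Finset.prod_le_prod (fun p _ => (hw0 _).le) fun p _ => hM _
    simp_rw [Finset.prod_insert has]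
    rw [integral_comp_plaquetteHolonomy_mul_of_mem hL a.1 (ne_of_lt a.2.2) hta hw.measurable hwb hΦm
      hΦb hΦe, ih hts hranks, Finset.card_insert_of_notMem has, pow_succ']

omit [TopologicalSpace G] [IsTopologicalGroup G] [CompactSpace G] [SecondCountableTopology G]
  [MeasurableSpace G] [BorelSpace G] in
/-- **The one-plaquette conditioners multiply to the normalised weight.**  For ANY assignment `t` of
links to the plaquettes of `B` and any constant `c`: the product over ALL links `b` of the
conditioners `q_b(U) = ∏_{p ∈ B, t p = b} w(U_p)/c` is `F_B(U)/c^{#B}` — every plaquette of `B` is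
counted exactly once, at its own top link. [ours] -/
theorem prod_conditioner_eq (w : G → ℝ) (c : ℝ) (B : Finset (Plaquette d L))
    (t : Plaquette d L → Edge d L) (U : GaugeConfig d L G) :
    ∏ b : Edge d L, ∏ p ∈ B.filter (fun p => t p = b), w (plaquetteHolonomy U p.1 p.2.1.1 p.2.1.2) / c =
      (∏ p ∈ B, w (plaquetteHolonomy U p.1 p.2.1.1 p.2.1.2)) / c ^ B.card := by
  classical
  rw [Finset.prod_fiberwise B t (fun p => w (plaquetteHolonomy U p.1 p.2.1.1 p.2.1.2) / c),
    Finset.prod_div_distrib, Finset.prod_const]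

end Summit.Ventures.LatticeQCDFlow.Theory2.Autoregressive
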